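import Summits.BirchSwinnertonDyer.BirchSwinnertonDyer.Theses.TwoAdicConverse
import Summits.BirchSwinnertonDyer.Rank1Residual.X5.TwoAdicAdditiveL2
import Summits.BirchSwinnertonDyer.Rank1Residual.X5.TwoAdicAdditiveL2Converse
import Summits.BirchSwinnertonDyer.Rank1Residual.X5.TwoAdicTargetsMultConverse
import Summits.BirchSwinnertonDyer.Rank1Residual.X5.TwoAdicTargetsMultKatoRat
import Summits.BirchSwinnertonDyer.BirchSwinnertonDyer.Theorems.TwoAdicConverseTwistSupply
import Literature.NumberTheory.EllipticCurves.BSDSelmerCMPConverseProofs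
import HarnessLib

/-!
# Route `TwoAdicConverse`, crux `MultiplicativeRankZeroTwoConverse` (item stmt-BirchSwinnertonDyer-19219):
# Theorems-side BRIDGE from the RN-2 road (nothing asserted)

The kernel certificate that the route's foreseen glued split
`MultiplicativeRankZeroTwoConverse ⇐ (twist supply) → (converse over K)` (route file, TWO-LAYER
PLAN) composes, stated against the REGISTERED crux constant
`Summit.BirchSwinnertonDyer.BirchSwinnertonDyer.Theses.TwoAdicConverse.MultiplicativeRankZeroTwoConverse`.
Road = the cell's PROVED 2-converse assembly `X5.AddTwoL2.analyticRank_eq_of_selmerCorank_two_eq`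
(RN-2): an auxiliary quadratic field `K` with `2` SPLIT in `K` (`X5.AddTwoL2Cyc.TwoSplit K`,
`d_K ≡ 1 (mod 8)`) and `L(E^(d_K),1) ≠ 0`; Kato's finiteness at `2` (Cor. 14.3, printed for every
`p`) kills the twist's Selmer corank, Dokchitser–Dokchitser Lemma 4.14 adds coranks under base
change, and the load-bearing input is the corank-`0` 2-CONVERSE OVER `K` (`X5.AddTwoL2.TwoConverseOverAt
W K 0`, the Burungale–Skinner–Tian–Wan Thm. 4.3 / Prop. 4.1 shape with its excluded prime `p = 2`
put back). Hypotheses, by tier: PRINT {`kato_finite_of_L_one_ne_zero · 2`,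
`selmerCorank_baseChange_quadratic`, `hasEntireLFunction_rat`} · OPEN over the class {the twist
supply with the local condition «2 split» (Friedberg–Hoffstein / Waldspurger with prescribed local
behaviour), the converse over `K`}. This is the planner's BC3 birth composition
`MultiplicativeRankZeroTwoConverse_of` (evidence on the item) with the stand-in replaced by the route
decl and the tree's predicate `TwoSplit` in place of the skeleton's local `TwoSplitIn`.

HONEST FRAMING (cell bsd-2adic, seat bsd-2adic-mult GEN 4): a COMPOSITION certificate for
`ledger route edit --split`; nothing is asserted; no class is closed. PARTITION: none — RANK axis
(S3); companion formula cell X5@2 mult (K4ᵐ, B1·O1; 1 976 book230 classes), object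
`ByReductionTypeAtTwo.MultiplicativeRankZeroAtTwo`, owner bsd-2adic.
[cite: Kato2004Asterisque, Cor 14.3] [cite: DokchitserDokchitser2010, Lemma 4.14]
[cite: BurungaleSkinnerTianWan2024, Thm 4.3 and Prop 4.1 (arXiv:2409.01350 p. 82)]
-/

set_option autoImplicit false
set_option linter.dupNamespace false

noncomputable section

open scoped Classical

open WeierstrassCurve Literature.NumberTheory.EllipticCurves
  Literature.NumberTheory.EllipticCurves.ModularForms
  Literature.NumberTheory.EllipticCurves.Greenberg1999
  Literature.NumberTheory.EllipticCurves.Rank1Residual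
  Literature.NumberTheory.EllipticCurves.Rank1Residual.Typed
  Summit.BirchSwinnertonDyer.Rank1Residual.X5

namespace Summit.BirchSwinnertonDyer.BirchSwinnertonDyer.Theorems

/-- **Bridge (RN-2 road ⇒ crux).** The PRINT bundle (Kato Cor. 14.3 at `2`, Dokchitser–Dokchitser
L. 4.14, modularity) + the twist supply «a quadratic `K` with `2` split and `L(E^(d_K),1) ≠ 0`» +
the corank-`0` 2-converse OVER such `K`, each ∀-closed over non-CM `E/ℚ` multiplicative at `2`,
imply the crux `MultiplicativeRankZeroTwoConverse`, by the proved assembly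
`AddTwoL2.analyticRank_eq_of_selmerCorank_two_eq` with admissibility predicate `AddTwoL2Cyc.TwoSplit`.
Composition certificate; nothing asserted. [cite: Kato2004Asterisque, Cor 14.3]
[cite: DokchitserDokchitser2010, Lemma 4.14]
[cite: BurungaleSkinnerTianWan2024, Thm 4.3 and Prop 4.1 (arXiv:2409.01350 p. 82)] -/
theorem multiplicativeRankZeroTwoConverse_of_overK
    (hP : (∀ (V : WeierstrassCurve ℚ) [V.IsElliptic], kato_finite_of_L_one_ne_zero V 2) ∧
      selmerCorank_baseChange_quadratic ∧ hasEntireLFunction_rat)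
    (hT : ∀ (W : WeierstrassCurve ℚ) [W.IsElliptic] [W.IsGloballyMinimal],
      ¬ W.HasCM → Mult W 2 →
        AddTwoL2.ExistsNonvanishingTwistWith W (fun K _ _ => AddTwoL2Cyc.TwoSplit K))
    (hK : ∀ (W : WeierstrassCurve ℚ) [W.IsElliptic] [W.IsGloballyMinimal],
      ¬ W.HasCM → Mult W 2 → ∀ (K : Type) [Field K] [NumberField K], Module.finrank ℚ K = 2 →
        AddTwoL2Cyc.TwoSplit K → (W.quadraticTwist (NumberField.discr K : ℚ)).entireLFunction 1 ≠ 0 →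
        AddTwoL2.TwoConverseOverAt W K 0) :
    Summit.BirchSwinnertonDyer.BirchSwinnertonDyer.Theses.TwoAdicConverse.MultiplicativeRankZeroTwoConverse := by
  unfold Summit.BirchSwinnertonDyer.BirchSwinnertonDyer.Theses.TwoAdicConverse.MultiplicativeRankZeroTwoConverse
  intro W _ _ hcm hmult hsel
  exact AddTwoL2.analyticRank_eq_of_selmerCorank_two_eq W (fun K _ _ => AddTwoL2Cyc.TwoSplit K) hP.1
    hP.2.1 hP.2.2 (hT W hcm hmult) 0 (fun K _ _ h2 hPK hL => hK W hcm hmult K h2 hPK hL) hsel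


/-! ## GEN 4 appendix — (i) the twist supply is PRINT (Hoffstein–Luo); (ii) the CYCLOTOMIC road

(i) `multiplicativeRankZeroTwoConverse_of_overK_of_hoffsteinLuo`: the ∀-closed twist-supply binder
`hT` of `multiplicativeRankZeroTwoConverse_of_overK` is discharged by
`existsNonvanishingTwistWith_twoSplit_of_hoffsteinLuo` (Theorems/TwoAdicConverseTwistSupply.lean)
modulo the named fact `HoffsteinLuo1997_exists_twist_L_one_ne_zero`: the RN-2 road then has ONE
open ∀-closed input, the corank-`0` 2-converse over `K` (`AddTwoL2.TwoConverseOverAt W K 0`).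
(ii) `multiplicativeRankZeroTwoConverse_of_multLowerRat`: the cell's CYCLOTOMIC road (T-mult-4,
`X5/TwoAdicTargetsMultConverse.lean`, p402103), ∀-closed: `corank Sel_{2^∞}(E/ℚ) = 0` ⇒ `Sel`
finite (`finite_selmerGroupPInfty_iff_selmerCorank_eq_zero`) ⇒ `L(E,1) ≠ 0 ∧ r_an = 0` by the
per-pair converses `O1.analyticRank_eq_zero_of_finite_selmer_{nonsplit,split}_two` from PRINT
{Greenberg's Thm-4.1 analogues at a multiplicative prime (A235/A236), modularity} + MEMO binders
{Kato `⊗ℚ` at a multiplicative `2` (`O1.KatoMultiplicativeDivisibilityRat`, PROOF-MULT; only «`X`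
torsion» is used), Greenberg–Stevens at `2` (`greenberg_stevens W 2`, PROOF-GS2, split case)} + the
ONE open ∀-closed object `O1.MultLowerDivisibilityAtTwoRat W` (the lower / Eisenstein-side `⊗ℚ`
divisibility for the Mazur–Tate–Teitelbaum function at a multiplicative `2`, T-mult-4) — the TWIN
(D-0056) of the formula crux's lower half: the 2-converse needs NO `μ`, NO period integrality and NO
upper half. Both are composition certificates; nothing is asserted. -/

/-- **Bridge (RN-2 road ⇒ crux, twist supply discharged).** As
`multiplicativeRankZeroTwoConverse_of_overK` with the twist-supply binder replaced by the named
PRINT fact `HoffsteinLuo1997_exists_twist_L_one_ne_zero` (via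
`existsNonvanishingTwistWith_twoSplit_of_hoffsteinLuo`): PRINT bundle + Hoffstein–Luo + the corank-`0`
2-converse over every quadratic `K` with `2` split and `L(E^(d_K),1) ≠ 0` ⇒
`MultiplicativeRankZeroTwoConverse`. [cite: HoffsteinLuo1997, Theorem (§1, pp. 435–436)]
[cite: Kato2004Asterisque, Cor 14.3] [cite: DokchitserDokchitser2010, Lemma 4.14]
[cite: BurungaleSkinnerTianWan2024, Thm 4.3 and Prop 4.1 (arXiv:2409.01350 p. 82)] -/
theorem multiplicativeRankZeroTwoConverse_of_overK_of_hoffsteinLuo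
    (hP : (∀ (V : WeierstrassCurve ℚ) [V.IsElliptic], kato_finite_of_L_one_ne_zero V 2) ∧
      selmerCorank_baseChange_quadratic ∧ hasEntireLFunction_rat)
    (hHL : HoffsteinLuo1997_exists_twist_L_one_ne_zero)
    (hK : ∀ (W : WeierstrassCurve ℚ) [W.IsElliptic] [W.IsGloballyMinimal],
      ¬ W.HasCM → Mult W 2 → ∀ (K : Type) [Field K] [NumberField K], Module.finrank ℚ K = 2 →
        AddTwoL2Cyc.TwoSplit K → (W.quadraticTwist (NumberField.discr K : ℚ)).entireLFunction 1 ≠ 0 →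
        AddTwoL2.TwoConverseOverAt W K 0) :
    Summit.BirchSwinnertonDyer.BirchSwinnertonDyer.Theses.TwoAdicConverse.MultiplicativeRankZeroTwoConverse :=
  multiplicativeRankZeroTwoConverse_of_overK hP
    (fun W _ _ _ _ => existsNonvanishingTwistWith_twoSplit_of_hoffsteinLuo hHL W) hK

/-- **Bridge (cyclotomic road ⇒ crux).** PRINT {A235 `h41ns`, A236 `h41sp`, modularity `hmod`} +
MEMO {Kato `⊗ℚ` at a multiplicative `2` (`hKato`, ∀-closed over non-CM `E` multiplicative at `2`),
Greenberg–Stevens at `2` (`hGS`, split case)} + the OPEN lower `⊗ℚ` divisibility T-mult-4 (`hlow'`,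
∀-closed) imply `MultiplicativeRankZeroTwoConverse`: corank `0` ⇒ `Sel_{2^∞}(E/ℚ)` finite ⇒
`r_an = 0` by `O1.analyticRank_eq_zero_of_finite_selmer_{nonsplit,split}_two`. Composition
certificate; nothing asserted. [cite: GreenbergLNM1716, §4 pp. 112–113]
[cite: MazurTateTeitelbaum1986Invent, §I.14] [cite: Kato2004Asterisque, Thm 17.4 and 17.13]
[cite: Kobayashi2006DocMath, Cor 4.2] -/
theorem multiplicativeRankZeroTwoConverse_of_multLowerRat
    (h41ns : thm41Analogue_charValue_rankZero_numberField_anyPrime)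
    (h41sp : thm41Analogue_charValue_rankZero_split_baseChange_anyPrime)
    (hmod : nonempty_modularParametrizationData)
    (hKato : ∀ (W : WeierstrassCurve ℚ) [W.IsElliptic] [W.IsGloballyMinimal],
      ¬ W.HasCM → Mult W 2 → O1.KatoMultiplicativeDivisibilityRat W 2)
    (hGS : ∀ (W : WeierstrassCurve ℚ) [W.IsElliptic] [W.IsGloballyMinimal],
      W.HasSplitMultiplicativeReductionAtPrime 2 → greenberg_stevens (W := W) (p := 2))
    (hlow' : ∀ (W : WeierstrassCurve ℚ) [W.IsElliptic] [W.IsGloballyMinimal],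
      ¬ W.HasCM → Mult W 2 → O1.MultLowerDivisibilityAtTwoRat W) :
    Summit.BirchSwinnertonDyer.BirchSwinnertonDyer.Theses.TwoAdicConverse.MultiplicativeRankZeroTwoConverse := by
  unfold Summit.BirchSwinnertonDyer.BirchSwinnertonDyer.Theses.TwoAdicConverse.MultiplicativeRankZeroTwoConverse
  intro W _ _ hcm hmult hsel
  haveI : Fact (Nat.Prime 2) := ⟨Nat.prime_two⟩
  have hfin : Finite (W.selmerGroupPInfty 2) :=
    (finite_selmerGroupPInfty_iff_selmerCorank_eq_zero W 2).mpr hsel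
  by_cases hsp : W.HasSplitMultiplicativeReductionAtPrime 2
  · exact (O1.analyticRank_eq_zero_of_finite_selmer_split_two W (hGS W hsp) h41sp hmod
      (fun f L => O1.katoDivisibilityAtTwoSplitMultRat_of_multRat W (hKato W hcm hmult) f L)
      (hlow' W hcm hmult) hmult hsp hfin).2
  · exact (O1.analyticRank_eq_zero_of_finite_selmer_nonsplit_two W h41ns hmod
      (fun f L => O1.katoDivisibilityAtTwoNonsplitMultRat_of_multRat W (hKato W hcm hmult) f L)
      (hlow' W hcm hmult) hmult hsp hfin).2

end Summit.BirchSwinnertonDyer.BirchSwinnertonDyer.Theorems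

end
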